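import Summits.CriticalPhenomena.SAWScalingLimit.Theorems.SAWLeftRightFKGFKGToTraversalBoundDomainMarkov
import Literature.Probability.Percolation.BoxCrossingProofs
import HarnessLib

/-!
# Helpers for `FKGGivesDomainMonotone` (stmt-CriticalPhenomena-8256): positive association and
conditioning on a down-closed sub-domain

Support item `FKGGivesDomainMonotone` of route `SAWTargetMonotonicity` is the implication
"positive association (PA) of the critical SAW chord measure for the lens-winding order ⇒
`DomainMonotone`".  Its proof plan is: `law_{Ω'} = law_Ω(· | E)` with `E` = "the chord stays in `Ω'_δ`",
`E` is a down-set, PA gives `law_Ω(U ∩ E) ≤ law_Ω(U) law_Ω(E)` for every up-set `U`.  This file proves the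
measure-theoretic and graph-theoretic half of that plan DEF-FREE over tree names, for ARBITRARY sets
`Ω' ⊆ Ω ⊆ ℂ` (the planar-topology half — the lens order is a preorder, `E` is a down-set — is not here):

* `edges_mem_edgeSet_of_subset` — a walk of `Ω'_δ` started at a site of `Ω_δ` is a walk of `Ω_δ`
  (`Ω' ⊆ Ω`; `Ω_δ` is a union of whole mesh components, `mem_meshDomain_of_meshGraph_adj`);
* `exists_transfer` — the support- and length-preserving injection `Φ : chords(Ω') ↪ chords(Ω)`
  (`SimpleGraph.Walk.transfer`), the weight identity `w_{Ω'}(A) = w_Ω(Φ '' A)` and the description of its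
  range (`γ ∈ range Φ ↔` every edge of `γ` is an edge of `Ω'_δ`); `weight_univ_ne_top`;
  `toCurve_append_reverse_congr` — the lens loop `p · q⁻¹` only depends on the two vertex sequences;
* `measure_inter_mul_le_of_posAssoc` — for a finite measure that is positively associated for the up-sets
  of a relation `r`, `μ(X ∩ D) μ(univ) ≤ μ(X) μ(D)` for every `r`-up-set `X` and measurable `r`-down-set `D`;
* `law_le_law_of_posAssoc` — CONDITIONING: if the `x_c`-weights on the chords of `Ω_δ` are PA for a
  preorder `r`, and "all edges in `Ω'_δ`" is an `r`-down-set, then for every event `A` of chords of `Ω'_δ`,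
  `law_{Ω'}(A) ≤ law_Ω {γ | ∃ γ' ∈ A, R γ' γ}` for any cross-domain relation `R` that agrees with `r` on equal
  vertex sequences — the Hall form of domain monotonicity used by `DomainMonotone`.

Only theorems; axioms are the standard three. [folklore]
-/

noncomputable section

open MeasureTheory Set
open scoped ENNReal
open Literature.Probability.LatticeModels
open Literature.Probability.RandomPlanarGeometry
open Literature.Probability.RandomPlanarGeometry.SAW
open Literature.Probability.Percolation (mem_meshDomain_of_meshGraph_adj)
open Summit.CriticalPhenomena.SAWScalingLimit.Theorems.FKGToTraversalBound.ExcursionDomination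
  (domainSAW_ext_support toCurve_eq_of_support_eq weight_eq_tsum_indicator weight_eq_tsum_preimage)

namespace Summit.CriticalPhenomena.SAWScalingLimit.Theorems.SAWTargetMonotonicity.FKGGivesDomainMonotone

variable {Ω Ω' : Set ℂ} {δ : ℝ} {a b : Site 2}

/-! ### Sub-domains: chords of `Ω'_δ` are chords of `Ω_δ` -/

/-- The mesh graph is monotone in the domain (edges are closed segments in `Ω̄`). [folklore] -/
theorem meshGraph_mono (h : Ω' ⊆ Ω) : meshGraph Ω' δ ≤ meshGraph Ω δ := by
  intro x y hxy
  rw [meshGraph_adj_iff] at hxy ⊢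
  exact ⟨hxy.1, hxy.2.trans (closure_mono h)⟩

/-- **A walk of `Ω'_δ` that starts at a site of `Ω_δ` is a walk of `Ω_δ`** (`Ω' ⊆ Ω`): all its edges are
edges of `Ω_δ` and it ends in `Ω_δ`.  (`Ω_δ = meshDomain Ω δ` is a union of whole components of the mesh
graph on mesh vertices, so it is entered but never left along mesh edges.) [folklore] -/
theorem edges_mem_edgeSet_of_subset (h : Ω' ⊆ Ω) :
    ∀ {x z : Site 2} (p : (discreteDomainGraph Ω' δ).Walk x z), x ∈ meshDomain Ω δ →
      (∀ e, e ∈ p.edges → e ∈ (discreteDomainGraph Ω δ).edgeSet) ∧ z ∈ meshDomain Ω δ := by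
  intro x z p
  induction p with
  | nil => intro hx; exact ⟨fun e he => by simp at he, hx⟩
  | @cons u v w huv p ih =>
    intro hu
    obtain ⟨hm, -, hv'⟩ := discreteDomainGraph_adj_iff.1 huv
    have hv : v ∈ meshDomain Ω δ :=
      mem_meshDomain_of_meshGraph_adj hu (h (meshDomain_subset_meshVertices _ _ hv'))
        (meshGraph_mono h hm)
    obtain ⟨ih1, ih2⟩ := ih hv
    refine ⟨fun e he => ?_, ih2⟩
    rw [SimpleGraph.Walk.edges_cons, List.mem_cons] at he
    rcases he with rfl | he
    · exact (SimpleGraph.mem_edgeSet _).2 (discreteDomainGraph_adj_iff.2 ⟨meshGraph_mono h hm, hu, hv⟩)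
    · exact ih1 e he

/-- **Transfer of chords to a larger domain.**  For `Ω' ⊆ Ω` and a source `a ∈ Ω_δ` there is an injection
`Φ` from the chords of `Ω'_δ` from `a` to `b` to those of `Ω_δ` preserving the vertex sequence and the
length, hence the `x_c`-weights of events (`w_{Ω'}(A) = w_Ω(Φ '' A)`), whose range is exactly the set of
chords of `Ω_δ` all of whose edges are edges of `Ω'_δ`. [folklore] -/
theorem exists_transfer (h : Ω' ⊆ Ω) (ha : a ∈ meshDomain Ω δ) :
    ∃ Φ : DomainSAW Ω' δ a b → DomainSAW Ω δ a b,
      Function.Injective Φ ∧ (∀ γ', (Φ γ').walk.support = γ'.walk.support) ∧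
      (∀ γ', (Φ γ').length = γ'.length) ∧
      (∀ A : Set (DomainSAW Ω' δ a b), weight Ω' δ a b A = weight Ω δ a b (Φ '' A)) ∧
      (∀ γ : DomainSAW Ω δ a b, γ ∈ Set.range Φ ↔
        ∀ e, e ∈ γ.walk.edges → e ∈ (discreteDomainGraph Ω' δ).edgeSet) := by
  classical
  let Φ : DomainSAW Ω' δ a b → DomainSAW Ω δ a b := fun γ' =>
    ⟨γ'.walk.transfer (discreteDomainGraph Ω δ) (edges_mem_edgeSet_of_subset h γ'.walk ha).1,
      γ'.isPath.transfer _⟩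
  have hsupp : ∀ γ', (Φ γ').walk.support = γ'.walk.support :=
    fun γ' => SimpleGraph.Walk.support_transfer _ _
  have hlen : ∀ γ', (Φ γ').length = γ'.length :=
    fun γ' => SimpleGraph.Walk.length_transfer _ _
  have hΦ : Function.Injective Φ := by
    intro γ₁ γ₂ hγ
    apply domainSAW_ext_support
    rw [← hsupp γ₁, ← hsupp γ₂, hγ]
  have hrange : ∀ γ : DomainSAW Ω δ a b, γ ∈ Set.range Φ ↔
      ∀ e, e ∈ γ.walk.edges → e ∈ (discreteDomainGraph Ω' δ).edgeSet := by
    intro γ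
    constructor
    · rintro ⟨γ', rfl⟩ e he
      have he' : e ∈ γ'.walk.edges := by
        rw [← SimpleGraph.Walk.edges_transfer γ'.walk (edges_mem_edgeSet_of_subset h γ'.walk ha).1]
        exact he
      exact γ'.walk.edges_subset_edgeSet he'
    · intro hγ
      refine ⟨⟨γ.walk.transfer _ hγ, γ.isPath.transfer hγ⟩, ?_⟩
      apply domainSAW_ext_support
      rw [hsupp, SimpleGraph.Walk.support_transfer]
  refine ⟨Φ, hΦ, hsupp, hlen, fun A => ?_, hrange⟩
  rw [weight_eq_tsum_preimage Φ hΦ (Set.image_subset_range Φ A), weight_eq_tsum_indicator,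
    hΦ.preimage_image]
  exact tsum_congr fun γ' => by simp only [hlen]

/-- A source joined to a different site inside `Ω_δ` lies in `Ω_δ`. [folklore] -/
theorem mem_meshDomain_of_reachable (hab : a ≠ b) (hr : (discreteDomainGraph Ω δ).Reachable a b) :
    a ∈ meshDomain Ω δ := by
  obtain ⟨p⟩ := hr
  cases p with
  | nil => exact absurd rfl hab
  | cons hadj _ => exact (discreteDomainGraph_adj_iff.1 hadj).2.1

/-- For finitely many chords the total `x_c`-mass is finite. [folklore] -/
theorem weight_univ_ne_top [Finite (DomainSAW Ω δ a b)] : weight Ω δ a b Set.univ ≠ ∞ := by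
  classical
  have := Fintype.ofFinite (DomainSAW Ω δ a b)
  rw [weight_eq_tsum_indicator, tsum_fintype]
  exact ENNReal.sum_ne_top.2 fun γ _ => by
    rw [Set.indicator_of_mem (Set.mem_univ γ)]; exact ENNReal.ofReal_ne_top

/-- **The lens loop only depends on the two vertex sequences.**  The mesh polyline of `p · q⁻¹` is the same
for walks `p, q` of one graph and `p', q'` of another with the same vertex sequences (e.g. the crux's
`γ₁.walk.append γ₂.walk.reverse` in `Ω_δ` versus `DomainMonotone`'s `Walk.mapLe` images in `ℤ²`), so the
two lens-winding relations agree. [folklore] -/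
theorem toCurve_append_reverse_congr {V E : Type*} [AddCommGroup E] [Module ℝ E] [TopologicalSpace E]
    [ContinuousAdd E] [ContinuousSMul ℝ E] {G G' : SimpleGraph V} {u v : V} (emb : V → E)
    {p q : G.Walk u v} {p' q' : G'.Walk u v} (hp : p.support = p'.support)
    (hq : q.support = q'.support) :
    (p.append q.reverse).toCurve emb = (p'.append q'.reverse).toCurve emb :=
  toCurve_eq_of_support_eq emb (by
    rw [SimpleGraph.Walk.support_append, SimpleGraph.Walk.support_append,
      SimpleGraph.Walk.support_reverse, SimpleGraph.Walk.support_reverse, hp, hq])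

/-! ### Positive association and conditioning on a down-set -/

/-- **PA controls conditioning on a down-set.**  Let `μ` be a finite measure and `r` a relation such that
`μ A · μ B ≤ μ univ · μ (A ∩ B)` for all `r`-up-closed `A`, `B`.  Then for every `r`-up-closed `X` and every
measurable `r`-down-closed `D`, `μ (X ∩ D) · μ univ ≤ μ X · μ D`, i.e. `μ(X | D) ≤ μ(X)`: apply PA to `X` and
the up-closed complement `Dᶜ` and cancel. [folklore] -/
theorem measure_inter_mul_le_of_posAssoc {α : Type*} [MeasurableSpace α] (μ : Measure α)
    (hfin : μ Set.univ ≠ ∞) (r : α → α → Prop)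
    (hPA : ∀ A B : Set α, (∀ x y, r x y → x ∈ A → y ∈ A) → (∀ x y, r x y → x ∈ B → y ∈ B) →
      μ A * μ B ≤ μ Set.univ * μ (A ∩ B))
    {X D : Set α} (hX : ∀ x y, r x y → x ∈ X → y ∈ X) (hD : ∀ x y, r x y → y ∈ D → x ∈ D)
    (hDm : MeasurableSet D) :
    μ (X ∩ D) * μ Set.univ ≤ μ X * μ D := by
  -- notation
  have hne : ∀ s : Set α, μ s ≠ ∞ := fun s => measure_ne_top_of_subset (Set.subset_univ s) hfin
  have hDc : ∀ x y, r x y → x ∈ Dᶜ → y ∈ Dᶜ := fun x y hxy hx hy => hx (hD x y hxy hy)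
  have hPA' := hPA X Dᶜ hX hDc
  rw [← Set.sdiff_eq] at hPA'
  -- `μ X = μ (X ∩ D) + μ (X \ D)` and `μ univ = μ D + μ Dᶜ`
  have hX' : μ (X ∩ D) + μ (X \ D) = μ X := measure_inter_add_sdiff X hDm
  have hU : μ D + μ Dᶜ = μ Set.univ := measure_add_measure_compl hDm
  -- from PA: `μ (X ∩ D) μ Dᶜ ≤ μ (X \ D) μ D`
  have key : μ (X ∩ D) * μ Dᶜ ≤ μ (X \ D) * μ D := by
    rw [← hX', ← hU, add_mul, add_mul] at hPA'
    -- hPA' : μ (X∩D) μ Dᶜ + μ (X\D) μ Dᶜ ≤ μ D μ (X\D) + μ Dᶜ μ (X\D)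
    have hfinprod : μ (X \ D) * μ Dᶜ ≠ ∞ := ENNReal.mul_ne_top (hne _) (hne _)
    calc μ (X ∩ D) * μ Dᶜ
        = μ (X ∩ D) * μ Dᶜ + μ (X \ D) * μ Dᶜ - μ (X \ D) * μ Dᶜ := by
          rw [ENNReal.add_sub_cancel_right hfinprod]
      _ ≤ (μ D * μ (X \ D) + μ Dᶜ * μ (X \ D)) - μ (X \ D) * μ Dᶜ := tsub_le_tsub_right hPA' _
      _ = μ (X \ D) * μ D := by
          rw [mul_comm (μ Dᶜ) (μ (X \ D)), ENNReal.add_sub_cancel_right hfinprod, mul_comm]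
  calc μ (X ∩ D) * μ Set.univ = μ (X ∩ D) * μ D + μ (X ∩ D) * μ Dᶜ := by rw [← hU, mul_add]
    _ ≤ μ (X ∩ D) * μ D + μ (X \ D) * μ D := add_le_add le_rfl key
    _ = μ X * μ D := by rw [← add_mul, hX']

/-- **Conditioning a positively associated chord measure on a down-closed sub-domain** (the mechanism
of `FKGGivesDomainMonotone`, with the planar topology abstracted into hypotheses).  Let `Ω' ⊆ Ω`, `a ∈ Ω_δ`,
and let the `x_c`-weights `w = SAW.weight Ω δ a b` have finite total mass.  Suppose `r` is a preorder on the
chords of `Ω_δ` for whose up-sets `w` is positively associated (`w(A) w(B) ≤ w(univ) w(A ∩ B)`), that the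
event "every edge is an edge of `Ω'_δ`" is `r`-down-closed, and that `R γ' γ` (a relation between chords of
`Ω'_δ` and of `Ω_δ`) agrees with `r γ₁ γ` whenever `γ₁` and `γ'` have the same vertex sequence.  Then for
every event `A` of chords of `Ω'_δ`,
`SAW.law Ω' δ a b A ≤ SAW.law Ω δ a b {γ | ∃ γ' ∈ A, R γ' γ}`:
indeed `law_{Ω'} = law_Ω(· | E)` with `E` the (down-closed) range of the transfer map, the target is an
up-set containing the image of `A`, and `measure_inter_mul_le_of_posAssoc` applies. [folklore] -/
theorem law_le_law_of_posAssoc (h : Ω' ⊆ Ω) (ha : a ∈ meshDomain Ω δ)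
    (hfin : weight Ω δ a b Set.univ ≠ ∞)
    (r : DomainSAW Ω δ a b → DomainSAW Ω δ a b → Prop) (hrefl : ∀ γ, r γ γ)
    (htrans : ∀ γ₁ γ₂ γ₃, r γ₁ γ₂ → r γ₂ γ₃ → r γ₁ γ₃)
    (hPA : ∀ A B : Set (DomainSAW Ω δ a b), (∀ γ₁ γ₂, r γ₁ γ₂ → γ₁ ∈ A → γ₂ ∈ A) →
      (∀ γ₁ γ₂, r γ₁ γ₂ → γ₁ ∈ B → γ₂ ∈ B) →
      weight Ω δ a b A * weight Ω δ a b B ≤ weight Ω δ a b Set.univ * weight Ω δ a b (A ∩ B))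
    (hdown : ∀ γ₁ γ₂ : DomainSAW Ω δ a b, r γ₁ γ₂ →
      (∀ e, e ∈ γ₂.walk.edges → e ∈ (discreteDomainGraph Ω' δ).edgeSet) →
      ∀ e, e ∈ γ₁.walk.edges → e ∈ (discreteDomainGraph Ω' δ).edgeSet)
    (R : DomainSAW Ω' δ a b → DomainSAW Ω δ a b → Prop)
    (hR : ∀ (γ' : DomainSAW Ω' δ a b) (γ₁ γ : DomainSAW Ω δ a b),
      γ₁.walk.support = γ'.walk.support → (R γ' γ ↔ r γ₁ γ))
    (A : Set (DomainSAW Ω' δ a b)) :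
    law Ω' δ a b A ≤ law Ω δ a b {γ | ∃ γ' ∈ A, R γ' γ} := by
  classical
  obtain ⟨Φ, hΦ, hsupp, -, hw, hrange⟩ := exists_transfer (b := b) h ha
  set w := weight Ω δ a b with hwdef
  set E : Set (DomainSAW Ω δ a b) := Set.range Φ with hE
  set X : Set (DomainSAW Ω δ a b) := {γ | ∃ γ' ∈ A, R γ' γ} with hXdef
  -- `R γ' γ ↔ r (Φ γ') γ`
  have hRΦ : ∀ γ' γ, R γ' γ ↔ r (Φ γ') γ := fun γ' γ => hR γ' (Φ γ') γ (hsupp γ')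
  -- `X` is an up-set, `E` a down-set, `Φ '' A ⊆ X ∩ E`
  have hX : ∀ γ₁ γ₂, r γ₁ γ₂ → γ₁ ∈ X → γ₂ ∈ X := by
    rintro γ₁ γ₂ h12 ⟨γ', hγ'A, hγ'⟩
    exact ⟨γ', hγ'A, (hRΦ γ' γ₂).2 (htrans _ _ _ ((hRΦ γ' γ₁).1 hγ') h12)⟩
  have hEd : ∀ γ₁ γ₂, r γ₁ γ₂ → γ₂ ∈ E → γ₁ ∈ E := by
    intro γ₁ γ₂ h12 h2
    rw [hE, hrange] at h2 ⊢
    exact hdown γ₁ γ₂ h12 h2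
  have hAXE : Φ '' A ⊆ X ∩ E := by
    rintro γ ⟨γ', hγ'A, rfl⟩
    exact ⟨⟨γ', hγ'A, (hRΦ γ' _).2 (hrefl _)⟩, Set.mem_range_self γ'⟩
  -- the abstract conditioning inequality
  have key : w (Φ '' A) * w Set.univ ≤ w X * w E :=
    (mul_le_mul' (measure_mono hAXE) le_rfl).trans
      (measure_inter_mul_le_of_posAssoc w hfin r hPA hX hEd MeasurableSpace.measurableSet_top)
  -- rewrite both laws through `w`
  have hlaw' : law Ω' δ a b A = (w E)⁻¹ * w (Φ '' A) := by
    rw [law, Measure.smul_apply, smul_eq_mul, hw Set.univ, hw A, Set.image_univ]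
  have hlaw : law Ω δ a b X = (w Set.univ)⁻¹ * w X := by
    rw [law, Measure.smul_apply, smul_eq_mul]
  rw [hlaw', hlaw]
  -- degenerate case `w E = 0`
  by_cases hE0 : w E = 0
  · have hA0 : w (Φ '' A) = 0 := measure_mono_null (hAXE.trans Set.inter_subset_right) hE0
    rw [hA0, mul_zero]
    exact bot_le
  have hEtop : w E ≠ ∞ := measure_ne_top_of_subset (Set.subset_univ _) hfin
  have hU0 : w Set.univ ≠ 0 := fun h0 => hE0 (measure_mono_null (Set.subset_univ _) h0)
  -- divide `key` by `w E · w univ`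
  calc (w E)⁻¹ * w (Φ '' A)
      = (w E)⁻¹ * w (Φ '' A) * ((w Set.univ)⁻¹ * w Set.univ) := by
        rw [ENNReal.inv_mul_cancel hU0 hfin, mul_one]
    _ = ((w E)⁻¹ * (w Set.univ)⁻¹) * (w (Φ '' A) * w Set.univ) := by ring
    _ ≤ ((w E)⁻¹ * (w Set.univ)⁻¹) * (w X * w E) := mul_le_mul' le_rfl key
    _ = (w Set.univ)⁻¹ * w X * ((w E)⁻¹ * w E) := by ring
    _ = (w Set.univ)⁻¹ * w X := by rw [ENNReal.inv_mul_cancel hE0 hEtop, mul_one]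

end Summit.CriticalPhenomena.SAWScalingLimit.Theorems.SAWTargetMonotonicity.FKGGivesDomainMonotone
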